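import Mathlib

/-!
# Crux `Block2InfDivXXZ` (stmt-HubbardSuperconductivity-15048, route `LevyLogBootstrap`):
# four Griffiths "triangle" inequalities of the SITE kernel give the `M = 4` block corner

Support file (registered sub-goal `block2Corner_of_siteTriangle`). On the `4 × 4` torus the
translation-invariant, `D₄`-symmetric transverse kernel `K` of the `S^z_tot = 0` sector ground state
takes the values `o = K(0) = 1/2`, `u = K(1,0)`, `v = K(1,1)`, `w = K(2,0)`, `x = K(2,1)`,
`y = K(2,2)`, and the `2 × 2`-block kernel on the coarse torus `(ℤ/2)²` has the three values
`A = k₂(0,0) = 4o + 8u + 4v`, `B = k₂(1,0) = k₂(0,1) = 4(u + v + w + x)`,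
`C = k₂(1,1) = 4(v + 2x + y)` (elementary block bookkeeping). By
`Block2InfDivXXZ_iff_levyCoeff_nonneg` (`…LevyEquivalence.lean`) the `M = 4` slice of the crux is
`ν₍₁,₀₎ = log A - log C ≥ 0 ∧ ν₍₁,₁₎ = log A - 2 log B + log C ≥ 0`, i.e. `C ≤ A` (block
Cauchy–Schwarz) and the CORNER inequality `B² ≤ A·C` — the triangle inequality
`d₂(1,1) ≤ d₂(1,0) + d₂(0,1)` for `d₂ = log (k₂(0)/k₂)`; on `(ℤ/2)²` a symmetric `d₂` with
`d₂(0) = 0` is of negative type iff it is a pseudo-metric (`levy_nonneg_of_corner` below records the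
two sign conditions).

**Theorem `block2Corner_of_siteTriangle`.** If `0 ≤ u, w`, `u, w, x ≤ o`, `0 < o` and the four
site-level product inequalities
`(C1) u² ≤ o v`, `(C2) u w ≤ o x`, `(C3) w² ≤ o y`, `(C4) w x ≤ o u` hold, then `B² ≤ A C`.
Proof: with `δ₁ = ov - u²`, `δ₂ = ox - uw`, `δ₃ = oy - w²` one has the identity
`o² (A C - B²)/16 = δ₁ (o - w)² + δ₁ δ₃ + δ₃ (o + u)² + δ₂ (2 (o + u)(o - w) - δ₂)` and
`δ₂ ≤ 2 (o + u)(o - w)` (if `2w ≤ o` because `δ₂ ≤ o x ≤ o²`; otherwise from `(C4)`: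
`w δ₂ ≤ u (o - w)(o + w) ≤ 2 w (o + u)(o - w)`). Equality holds on the `ℓ¹`-exponential family
`(u,v,w,x,y) = o (r, r², r²(1+ε), r³(1+ε), r⁴(1+ε)²)`.

(C1)–(C4) are instances `K(a) K(b) ≤ K(0) K(a + b)` (`(1,0)+(0,1)`, `(1,0)+(0,2)`, `(2,0)+(0,2)`,
`(2,0)+(2,1) = (0,1)` on `ℤ/4`) of the GRIFFITHS–GINIBRE inequality of the second kind for pairs of
in-plane spin components, `¼⟨S¹_0 S¹_z⟩ ≥ ⟨S¹_0 S¹_x⟩⟨S¹_x S¹_z⟩` (spin ½: `(S¹_x)² = ¼`), which is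
a theorem for the quantum XY model (`Δ = 0`) in every Gibbs state — Benassi–Lees–Ueltschi,
J. Stat. Phys. 164 (2016) 1157–1166, Thm. 1 (arXiv:1510.03215; Gallavotti 1971 for pair
interactions) — and passes to the ground state when it is unique
(`groundSpace_xxzTorus_le_spinZSector_zero`, `xxz_sector_perronFrobenius`); for `Δ < 0` it is an
open conjecture (numerically true at `M = 4` on all of `[-1, 0]`, evidence
`EVIDENCE-griffiths-metric-w12.md` on the item). So this file turns the `M = 4` instance of the crux
into four Griffiths inequalities of the site kernel — a structural route that is neither reflection
positivity nor Bochner. No definition is introduced; sorry-free; pure real arithmetic.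
-/

-- the mandated namespace `Summit.<Summit>.<Problem>.Theorems` repeats `HubbardSuperconductivity`
set_option linter.dupNamespace false

namespace Summit.HubbardSuperconductivity.HubbardSuperconductivity.Theorems.LevyLogBootstrap

set_option linter.style.longLine false in
/-- **Registered sub-goal `block2Corner_of_siteTriangle` (crux `Block2InfDivXXZ`, `M = 4`).**
Four Griffiths "triangle" inequalities of the site kernel values `o = K(0)`, `u = K(1,0)`,
`v = K(1,1)`, `w = K(2,0)`, `x = K(2,1)`, `y = K(2,2)` (with `0 ≤ u, w`, `u, w, x ≤ o`, `0 < o`) imply the block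
corner inequality `k₂(1,0)² ≤ k₂(0,0) k₂(1,1)` for `k₂(0,0) = 4o+8u+4v`, `k₂(1,0) = 4(u+v+w+x)`,
`k₂(1,1) = 4(v+2x+y)`. Certificate: `o²(AC - B²)/16 = δ₁(o-w)² + δ₁δ₃ + δ₃(o+u)² + δ₂(2(o+u)(o-w) - δ₂)`
with `δ₁ = ov-u²`, `δ₂ = ox-uw`, `δ₃ = oy-w²`, and `δ₂ ≤ 2(o+u)(o-w)`.
[cite: BenassiLeesUeltschi2016, Thm. 1 (the hypotheses (C1)–(C4) at Δ = 0)] -/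
theorem block2Corner_of_siteTriangle : ∀ (o u v w x y : ℝ), 0 < o → 0 ≤ u → 0 ≤ w → u ≤ o → w ≤ o → x ≤ o → u * u ≤ o * v → u * w ≤ o * x → w * w ≤ o * y → w * x ≤ o * u → (4 * (u + v + w + x)) ^ 2 ≤ (4 * o + 8 * u + 4 * v) * (4 * v + 8 * x + 4 * y) := by
  intro o u v w x y ho hu hw hu1 hw1 hx1 C1 C2 C3 C4
  -- the three nonnegative slacks
  have hd1 : 0 ≤ o * v - u * u := by linarith
  have hd2 : 0 ≤ o * x - u * w := by linarith
  have hd3 : 0 ≤ o * y - w * w := by linarith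
  -- key bound: δ₂ ≤ 2 (o + u) (o - w)
  have hkey : o * x - u * w ≤ 2 * (o + u) * (o - w) := by
    by_cases h2w : 2 * w ≤ o
    · -- δ₂ ≤ o x ≤ o² ≤ (o + u) o ≤ 2 (o + u) (o - w)
      have h1 : o * x - u * w ≤ o * o := by nlinarith
      nlinarith
    · push Not at h2w
      have hwpos : 0 < w := by linarith
      -- w δ₂ ≤ u (o - w)(o + w) ≤ 2 w (o + u)(o - w)
      have h1 : w * (o * x - u * w) ≤ u * (o - w) * (o + w) := by nlinarith
      have h2 : u * (o - w) * (o + w) ≤ w * (2 * (o + u) * (o - w)) := by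
        have how : 0 ≤ o - w := by linarith
        nlinarith [mul_nonneg how (by linarith : (0:ℝ) ≤ 2 * w - u), mul_nonneg how (mul_nonneg hw hu)]
      exact le_of_mul_le_mul_left (h1.trans h2) hwpos
  -- the certificate
  have hcert : o ^ 2 * ((4 * o + 8 * u + 4 * v) * (4 * v + 8 * x + 4 * y) - (4 * (u + v + w + x)) ^ 2)
      = 16 * ((o * v - u * u) * (o - w) ^ 2 + (o * v - u * u) * (o * y - w * w)
          + (o * y - w * w) * (o + u) ^ 2
          + (o * x - u * w) * (2 * (o + u) * (o - w) - (o * x - u * w))) := by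
    ring
  have hR : 0 ≤ (o * v - u * u) * (o - w) ^ 2 + (o * v - u * u) * (o * y - w * w)
          + (o * y - w * w) * (o + u) ^ 2
          + (o * x - u * w) * (2 * (o + u) * (o - w) - (o * x - u * w)) := by
    have t1 : 0 ≤ (o * v - u * u) * (o - w) ^ 2 := mul_nonneg hd1 (sq_nonneg _)
    have t2 : 0 ≤ (o * v - u * u) * (o * y - w * w) := mul_nonneg hd1 hd3
    have t3 : 0 ≤ (o * y - w * w) * (o + u) ^ 2 := mul_nonneg hd3 (sq_nonneg _)
    have t4 : 0 ≤ (o * x - u * w) * (2 * (o + u) * (o - w) - (o * x - u * w)) :=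
      mul_nonneg hd2 (by linarith)
    linarith
  have hsq : 0 ≤ o ^ 2 * ((4 * o + 8 * u + 4 * v) * (4 * v + 8 * x + 4 * y)
      - (4 * (u + v + w + x)) ^ 2) := by rw [hcert]; positivity
  have ho2 : 0 < o ^ 2 := by positivity
  nlinarith [(mul_nonneg_iff_of_pos_left ho2).mp hsq]

/-- **The two `M = 4` Lévy sign conditions from the corner.** On the coarse torus `(ℤ/2)²` with
block values `A = k₂(0,0)`, `B = k₂(1,0) = k₂(0,1)`, `C = k₂(1,1)`, all positive, `C ≤ A` and
`B² ≤ A C` give `ν₍₁,₀₎ = log A - log B + log B - log C ≥ 0` and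
`ν₍₁,₁₎ = log A - log B - log B + log C ≥ 0` (the form certified in `EVIDENCE-certm4.md` and
reduced to in `…LevyEquivalence.lean`): a symmetric function on `(ℤ/2)²` vanishing at `0` is of
negative type iff it satisfies the triangle inequalities. [folklore] -/
theorem levy_nonneg_of_corner (A B C : ℝ) (hB : 0 < B) (hC : 0 < C)
    (hCA : C ≤ A) (hcorner : B ^ 2 ≤ A * C) :
    0 ≤ Real.log A - Real.log B + Real.log B - Real.log C ∧
      0 ≤ Real.log A - Real.log B - Real.log B + Real.log C := by
  have hA : 0 < A := lt_of_lt_of_le hC hCA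
  refine ⟨?_, ?_⟩
  · have := Real.log_le_log hC hCA
    linarith
  · have h1 : Real.log (B ^ 2) ≤ Real.log (A * C) :=
      Real.log_le_log (by positivity) hcorner
    rw [Real.log_pow, Real.log_mul hA.ne' hC.ne'] at h1
    push_cast at h1
    linarith

/-- **Corner from the four Griffiths inequalities, Lévy form (`M = 4`).** Combining the two
theorems above: the site-level inequalities (C1)–(C4) together with the block Cauchy–Schwarz bound
`k₂(1,1) ≤ k₂(0,0)` give both `M = 4` Lévy sign conditions. [folklore] -/
theorem levy_nonneg_of_siteTriangle (o u v w x y : ℝ) (ho : 0 < o)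
    (hu : 0 ≤ u) (hw : 0 ≤ w) (hu1 : u ≤ o) (hw1 : w ≤ o) (hx1 : x ≤ o)
    (C1 : u * u ≤ o * v) (C2 : u * w ≤ o * x) (C3 : w * w ≤ o * y) (C4 : w * x ≤ o * u)
    (hBpos : 0 < 4 * (u + v + w + x)) (hCpos : 0 < 4 * v + 8 * x + 4 * y)
    (hCA : 4 * v + 8 * x + 4 * y ≤ 4 * o + 8 * u + 4 * v) :
    0 ≤ Real.log (4 * o + 8 * u + 4 * v) - Real.log (4 * (u + v + w + x))
        + Real.log (4 * (u + v + w + x)) - Real.log (4 * v + 8 * x + 4 * y) ∧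
      0 ≤ Real.log (4 * o + 8 * u + 4 * v) - Real.log (4 * (u + v + w + x))
        - Real.log (4 * (u + v + w + x)) + Real.log (4 * v + 8 * x + 4 * y) :=
  levy_nonneg_of_corner _ _ _ hBpos hCpos hCA
    (block2Corner_of_siteTriangle o u v w x y ho hu hw hu1 hw1 hx1 C1 C2 C3 C4)

end Summit.HubbardSuperconductivity.HubbardSuperconductivity.Theorems.LevyLogBootstrap
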